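import Mathlib
import Summits.ABC.ABC.Theses.ThreeSlotCyclotomicDescent
import Literature.NumberTheory.DiophantineGeometry.ClassicalPellPowerFacts
import Summits.ABC.ABC.Theorems.ThreeSlotL4Empty
import Summits.ABC.ABC.Theorems.SolvedZooCohnOddExponent
import Summits.ABC.ABC.Theorems.SolvedZooL1Consumer
import Summits.ABC.ABC.Theorems.SolvedZooL2Consumer
import Summits.ABC.ABC.Theorems.SolvedZooL3Consumer
import Summits.ABC.ABC.Theorems.SolvedZooL3EvenExponentEmpty
import Summits.ABC.ABC.Theorems.SolvedZooL3BaseThreeOddExponent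

/-!
# Family L3 of the solved zoo is `{(1, 242, 243)}` UNCONDITIONALLY; `SolvedZooABC` ⇐ four named facts

Follow-up of `SolvedZooL3Consumer.lean` (★ p608824, `solvedZoo_L3_of (hL : Ljunggren 1943 inline)`) and of
`SolvedZooAssemblyModFacts.lean` (★ p611328, `solvedZooABC_of_facts (hF1) (hF2) (hF3) (h₂) (h₃)`; not
imported — this file imports the route file directly, per the gate's theses-cone lint), for the crux `Summit.ABC.ABC.Theses.ThreeSlotCyclotomicDescent.SolvedZooABC` (stmt-ABC-24025,
`route-ABC-ThreeSlotCyclotomicDescent`).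

The named fact F2 = `Literature.NumberTheory.DiophantineGeometry.ljunggren1943_geomSumEqSquare`
(Ljunggren 1943, `(xⁿ − 1)/(x − 1) = y²`) was used by family (iii) (`r^z = 2^x·q² + 1`, `q, r` prime, `r, z`
odd, `z ≥ 3`) ONLY at base `x = 3` with odd exponent, after the in-tree reductions
`SolvedZooL3Reduction.l3_reduce` (★ p608595: `r = 2^x + 1`) and `l3_base_eq_three` (★ p609707: even `x ≥ 2`
empty by Cohn's negative-Pell count, `x` odd ⇒ `r = 3`, `x = 1`). That slice — `2q² + 1 = 3^z`, `z` odd ⇒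
`(z, q) ∈ {(1, 1), (5, 11)}` — is now the THEOREM `two_mul_sq_add_one_eq_three_pow_of_odd` /
`l3_base_three` of `SolvedZooL3BaseThreeOddExponent.lean` (Pell descent + the `(27, 17)` period-`18`
congruence certificate). Hence:

* `l3_params` — the data of family (iii) are forced UNCONDITIONALLY: `x = 1, q = 11, r = 3, z = 5`;
* `l3_triple_eq` / `l3_triple_eq_swap` — the triple is `(1, 242, 243)` / `(242, 1, 243)`;
* `solvedZoo_L3_unconditional` — the L3 conjunct of `SolvedZooABC` (family (iii) ∨ swap) in abc(ε) form
  with the explicit constant `C = 10` for every `ε > 0`, NO hypothesis (F2 DISCHARGED for the zoo);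
* `solvedZooABC_of_facts4 (hF1) (hF3) (h₂) (h₃) : SolvedZooABC` — the assembly with `hF2` DROPPED: the
  crux follows from the FOUR named facts [Ljunggren1942] `ljunggren1942_sqPlusOneEqTwiceFourth` (L2, with
  the theorem `cohn1996_lemma_odd`; itself ⇐ the leaf `SimplestQuarticThueSolutions` via
  `SolvedZooL2QuarticBridge.lean`, ★ p610666), [Le2002] `le2002_sqPlusPow2EqPow` (L1),
  [DarmonMerel1997] Main Thm (2) `darmonMerel1997_sumOfPowersEqSquare` and (3)
  `darmonMerel1997_sumOfPowersEqCube` (L4);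

PROOF-ONLY file (no definitions, no named facts, no `sorry`); serves stmt-ABC-24025 `--supports … --as
helper` WITHOUT closing it. BOOKING: «24025 = PROVED-MOD-FACTS {ljunggren1942_sqPlusOneEqTwiceFourth
(⇐ SimplestQuarticThueSolutions), le2002_sqPlusPow2EqPow, darmonMerel1997_sumOfPowersEqSquare,
darmonMerel1997_sumOfPowersEqCube} — n = 4 named, 0 raw binders; F2 Ljunggren 1943 DISCHARGED for the zoo
(its `x = 3`, odd-`n` case proved in tree); Cohn 1996 odd half a THEOREM; item OPEN».
HONESTY (INPUTS→UNCONDITIONAL, D-0154 (2)): proving a printed input makes a conditional line unconditional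
AS TYPED; kernel-checked implication for the rest; PROVED-MOD-FACTS ≠ proved; abc moved by 0; NOT abc,
NOT A-PS; typed ≠ proved.
-/

namespace Summit.ABC.ABC.Theorems.SolvedZooL3Unconditional

open Literature.NumberTheory.DiophantineGeometry (IsABCTriple rad rad_swap
  ljunggren1942_sqPlusOneEqTwiceFourth le2002_sqPlusPow2EqPow
  darmonMerel1997_sumOfPowersEqSquare darmonMerel1997_sumOfPowersEqCube)
open Summit.ABC.ABC.Theses.ThreeSlotCyclotomicDescent (SolvedZooABC)
open Summit.ABC.ABC.Theorems.ThreeSlotL4Empty (solvedZoo_L4)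
open Summit.ABC.ABC.Theorems.SolvedZooL3Reduction (l3_reduce)
open Summit.ABC.ABC.Theorems.SolvedZooL1Consumer (solvedZoo_L1_of)
open Summit.ABC.ABC.Theorems.SolvedZooL2Consumer (solvedZoo_L2_of)
open Summit.ABC.ABC.Theorems.SolvedZooL3Consumer (sixtysix_le_rad lt_mul_rpow_of_lt_mul)

/-- **Parameters of family (iii), unconditionally.** If `r ^ z = 2 ^ x * q ^ 2 + 1` with `q, r` prime,
`r` odd, `z` odd, `3 ≤ z`, then `x = 1`, `q = 11`, `r = 3`, `z = 5` (`3⁵ = 2·11² + 1`). Chain: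
`l3_reduce` (`r = 2^x + 1`) → `l3_base_eq_three` (`r = 3`, `x = 1`) → `l3_base_three`
(`2q² + 1 = 3^z`, `z` odd ⇒ `z = 5`, `q = 11`). No named fact. [folklore] -/
theorem l3_params {x q r z : ℕ} (hq : q.Prime) (hr : r.Prime) (hro : Odd r) (hz : Odd z) (h3 : 3 ≤ z)
    (h : r ^ z = 2 ^ x * q ^ 2 + 1) :
    x = 1 ∧ q = 11 ∧ r = 3 ∧ z = 5 := by
  obtain ⟨-, hrx⟩ := l3_reduce hq hr.one_lt hz h3 h
  obtain ⟨rfl, rfl⟩ := l3_base_eq_three hr hro hrx hz h3 h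
  obtain ⟨rfl, rfl⟩ := l3_base_three hz h3 h
  exact ⟨rfl, rfl, rfl, rfl⟩

/-- **Family (iii) is the single triple `(1, 242, 243)`**, unconditionally. [folklore] -/
theorem l3_triple_eq {a b c : ℕ} (ht : IsABCTriple a b c)
    (hfam : ∃ x q r z : ℕ, q.Prime ∧ r.Prime ∧ Odd r ∧ Odd z ∧ 3 ≤ z ∧ a = 1 ∧
      b = 2 ^ x * q ^ 2 ∧ c = r ^ z) :
    a = 1 ∧ b = 242 ∧ c = 243 := by
  obtain ⟨x, q, r, z, hq, hr, hro, hz, h3, rfl, rfl, rfl⟩ := hfam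
  have h : r ^ z = 2 ^ x * q ^ 2 + 1 := by have := ht.2.2.1; omega
  obtain ⟨rfl, rfl, rfl, rfl⟩ := l3_params hq hr hro hz h3 h
  norm_num

/-- The swapped orientation: family (iii) with `b = 1` is the single triple `(242, 1, 243)`,
unconditionally. [folklore] -/
theorem l3_triple_eq_swap {a b c : ℕ} (ht : IsABCTriple a b c)
    (hfam : ∃ x q r z : ℕ, q.Prime ∧ r.Prime ∧ Odd r ∧ Odd z ∧ 3 ≤ z ∧ b = 1 ∧
      a = 2 ^ x * q ^ 2 ∧ c = r ^ z) :
    a = 242 ∧ b = 1 ∧ c = 243 := by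
  obtain ⟨x, q, r, z, hq, hr, hro, hz, h3, rfl, rfl, rfl⟩ := hfam
  have h : r ^ z = 2 ^ x * q ^ 2 + 1 := by have := ht.2.2.1; omega
  obtain ⟨rfl, rfl, rfl, rfl⟩ := l3_params hq hr hro hz h3 h
  norm_num

/-- **The L3 conjunct of `SolvedZooABC` (stmt-ABC-24025), UNCONDITIONAL.** Family (iii) ∨ its swap in
abc(ε) form: for every `ε > 0` the constant `C = 10` works, since the family is `{(1, 242, 243)}` ∪ swap
and `243 < 10 · 66 ≤ 10 · rad ≤ 10 · rad^(1+ε)`. Same bookkeeping as `SolvedZooL3Consumer.solvedZoo_L3_of`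
(★ p608824), with its Ljunggren-1943 hypothesis `hL` DISCHARGED by the in-tree theorem
`two_mul_sq_add_one_eq_three_pow_of_odd` (only the `x = 3`, odd-`n` slice of F2 was ever used). This is
ONE conjunct of stmt-ABC-24025, which stays OPEN; not abc. [folklore] -/
theorem solvedZoo_L3_unconditional :
    ∀ ε : ℝ, 0 < ε → ∃ C : ℝ, 0 < C ∧ ∀ a b c : ℕ, IsABCTriple a b c →
      ((∃ x q r z : ℕ, q.Prime ∧ r.Prime ∧ Odd r ∧ Odd z ∧ 3 ≤ z ∧ a = 1 ∧
          b = 2 ^ x * q ^ 2 ∧ c = r ^ z) ∨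
       (∃ x q r z : ℕ, q.Prime ∧ r.Prime ∧ Odd r ∧ Odd z ∧ 3 ≤ z ∧ b = 1 ∧
          a = 2 ^ x * q ^ 2 ∧ c = r ^ z)) →
      (c : ℝ) < C * ((rad a b c : ℕ) : ℝ) ^ (1 + ε) := by
  intro ε hε
  refine ⟨10, by norm_num, ?_⟩
  rintro a b c ht (hfam | hfam)
  · obtain ⟨rfl, rfl, rfl⟩ := l3_triple_eq ht hfam
    exact lt_mul_rpow_of_lt_mul (le_trans (by norm_num) sixtysix_le_rad) (by norm_num)
      (by have h66 : (66 : ℝ) ≤ (rad 1 242 243 : ℕ) := by exact_mod_cast sixtysix_le_rad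
          push_cast; linarith) hε
  · obtain ⟨rfl, rfl, rfl⟩ := l3_triple_eq_swap ht hfam
    have hsw : rad 242 1 243 = rad 1 242 243 := rad_swap 1 242 243
    exact lt_mul_rpow_of_lt_mul (le_trans (by norm_num) (hsw ▸ sixtysix_le_rad)) (by norm_num)
      (by have h66 : (66 : ℝ) ≤ (rad 242 1 243 : ℕ) := by rw [hsw]; exact_mod_cast sixtysix_le_rad
          push_cast; linarith) hε

/-- **ASSEMBLY with `hF2` DROPPED: `SolvedZooABC` (stmt-ABC-24025) ⇐ FOUR named facts, BY NAME.**
[Ljunggren1942] `hF1` (closes L2 together with the THEOREM `cohn1996_lemma_odd`, ★ p609304), [Le2002] `hF3`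
(closes L1), [DarmonMerel1997, Main Theorem (2)] `h₂` and (3) `h₃` (close L4); L3 is the unconditional
`solvedZoo_L3_unconditional`. Constant `C = max (max C₁ C₂) (max C₃ C₄)`. Kernel-checked IMPLICATION only:
24025 is NOT closed by this theorem (facts remaining n = 4, all named, 0 raw binders); PROVED-MOD-FACTS ≠
proved; not abc, abc moved by 0. [folklore] -/
theorem solvedZooABC_of_facts4 (hF1 : ljunggren1942_sqPlusOneEqTwiceFourth)
    (hF3 : le2002_sqPlusPow2EqPow) (h₂ : darmonMerel1997_sumOfPowersEqSquare)
    (h₃ : darmonMerel1997_sumOfPowersEqCube) : SolvedZooABC := by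
  -- the quartic hypothesis shape of `SolvedZooL2Consumer` from [Ljunggren1942] (`x = 0`, `t = 0` are
  -- excluded by parity / positivity; same two lines as `SolvedZooAssemblyModFacts.quartic_of_ljunggren1942`,
  -- inlined so that this file imports the route file directly and no module above it)
  have hQuartic : ∀ x t : ℕ, x ^ 2 + 1 = 2 * t ^ 4 → t = 1 ∨ t = 13 := by
    intro x t hxt
    have hx : 0 < x := by
      refine Nat.pos_of_ne_zero ?_
      rintro rfl
      rw [zero_pow two_ne_zero, zero_add] at hxt
      omega
    have ht : 0 < t := by
      refine Nat.pos_of_ne_zero ?_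
      rintro rfl
      rw [zero_pow four_ne_zero, mul_zero] at hxt
      omega
    rcases hF1 x t hx ht hxt with ⟨-, h1⟩ | ⟨-, h13⟩
    · exact Or.inl h1
    · exact Or.inr h13
  unfold SolvedZooABC
  intro ε hε
  obtain ⟨C₁, hC₁, H1⟩ := solvedZoo_L1_of hF3 ε hε
  obtain ⟨C₂, hC₂, H2⟩ := solvedZoo_L2_of cohn1996_lemma_odd hQuartic ε hε
  obtain ⟨C₃, hC₃, H3⟩ := solvedZoo_L3_unconditional ε hε
  obtain ⟨C₄, hC₄, H4⟩ := solvedZoo_L4 h₂ h₃ ε hε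
  refine ⟨max (max C₁ C₂) (max C₃ C₄), lt_max_of_lt_left (lt_max_of_lt_left hC₁), ?_⟩
  intro a b c ht hfam
  have hr : (0 : ℝ) ≤ ((rad a b c : ℕ) : ℝ) ^ (1 + ε) := Real.rpow_nonneg (Nat.cast_nonneg _) _
  rcases hfam with (h1 | h2 | h3 | h4) | (h1 | h2 | h3 | h4)
  · exact (H1 a b c ht (Or.inl h1)).trans_le
      (mul_le_mul_of_nonneg_right ((le_max_left _ _).trans (le_max_left _ _)) hr)
  · exact (H2 a b c ht (Or.inl h2)).trans_le
      (mul_le_mul_of_nonneg_right ((le_max_right _ _).trans (le_max_left _ _)) hr)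
  · exact (H3 a b c ht (Or.inl h3)).trans_le
      (mul_le_mul_of_nonneg_right ((le_max_left _ _).trans (le_max_right _ _)) hr)
  · exact (H4 a b c ht (Or.inl h4)).trans_le
      (mul_le_mul_of_nonneg_right ((le_max_right _ _).trans (le_max_right _ _)) hr)
  · exact (H1 a b c ht (Or.inr h1)).trans_le
      (mul_le_mul_of_nonneg_right ((le_max_left _ _).trans (le_max_left _ _)) hr)
  · exact (H2 a b c ht (Or.inr h2)).trans_le
      (mul_le_mul_of_nonneg_right ((le_max_right _ _).trans (le_max_left _ _)) hr)
  · exact (H3 a b c ht (Or.inr h3)).trans_le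
      (mul_le_mul_of_nonneg_right ((le_max_left _ _).trans (le_max_right _ _)) hr)
  · exact (H4 a b c ht (Or.inr h4)).trans_le
      (mul_le_mul_of_nonneg_right ((le_max_right _ _).trans (le_max_right _ _)) hr)

end Summit.ABC.ABC.Theorems.SolvedZooL3Unconditional
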